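import Summits.KontsevichZagierPeriods.KontsevichZagierPeriods.Theses.StandardParts
import Summits.KontsevichZagierPeriods.KontsevichZagierPeriods.Theses.InequalityCost
import Literature.NumberTheory.Transcendental.KZTameMoveFamily

/-!
# `SpTameUniformClosure` (stmt-KontsevichZagierPeriods-18036, route StandardParts) — BIRTH SKELETON

Piece X₃ of the crux-strategist's BC2-redirect split of the deciding crux `SpArcLifting` (stmt-3155):
**TAME UNIFORM CLOSURE** — if two `N`-tame raw `ℚ`-semialgebraic families `S` (dim `k`), `S'` (dim `k'`)
have their difference of fibre generators `t ↦ S.gen t − S'.gen t` equal to ONE tame uniform chain over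
`(0, δ)` (`KZ.TameUniformChainOn N (Ioo 0 δ)`: finitely many `N`-tame raw move families with signs), and
`S →_{L¹} ρ₀`, `S' →_{L¹} ρ₀'` as `t → 0⁺`, then `KZ.Equivalent ρ₀ ρ₀'`.

The crux (FIXED, never restated here):
`Summit.KontsevichZagierPeriods.KontsevichZagierPeriods.Theses.StandardParts.SpTameUniformClosure`.

## The line: per-move tame closure + limits of the intermediates + symbol bookkeeping

This is route InequalityCost's foreseen `UniformClosure` (TWO-LAYER PLAN of that route: "uniform tame
template family with L¹-endpoints (A,B) ⇒ A ~ B: TameLimitExists + per-move lemmas + symbol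
bookkeeping") and this route's foreseen `SpUniformClosure` in its tame case. The stubs are the per-move
TAME CLOSURE lemmas, typed over the move-family structures of `KZTameMoveFamily.lean` (whose fields are,
clause by clause, the side conditions of the InequalityCost items — so each per-move stub is IMPLIED by
the corresponding InequalityCost item, proved below: `domainAddFamilyLimits_of_addLimits`,
`covFamilyLimit_of_tameCovLimit`, `nlFamilyLimit_of_tameNLLimit`, `tameFamilyLimitExists_of_tameLimitExists`;
closing items 8991 / 8987 / 8989 / 8992 closes the four stubs), plus ONE bookkeeping stub:

* `stub_addFamilyLimits` (M; ⟸ InequalityCost.AddLimits, item 8991, provable-now): `L¹`-limits of a tame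
  family of domain-additivity (resp. integrand-additivity) instances satisfy `[r] − [r₁] − [r₂] ∈ relations`.
* `stub_covFamilyLimit` (L; ⟸ InequalityCost.TameCovLimit, item 8987, crux rank 2 there): `L¹`-limits of
  a tame family of change-of-variables instances are `KZ.Equivalent` (degenerating Jacobians are the content).
* `stub_nlFamilyLimit` (L; ⟸ InequalityCost.TameNLLimit, item 8989): the same for Newton–Leibniz families.
* `stub_tameFamilyLimitExists` (M; ⟸ InequalityCost.TameLimitExists, item 8992, provable-now): every tame
  raw family HAS an `L¹`-limit representation at `0⁺` (o-minimal monotonicity + dominated convergence).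
* `stub_symbolBookkeeping` (L, the hardest NEW work): the four statements above imply the crux — rescale
  `(0, δ)` to `(0, 1)` (`RawMoveFamilyOn.rescale`, tameness bound enlarged to `⌈N/δ⌉`), give every
  intermediate tame family its limit representation (`stub_tameFamilyLimitExists`), observe that the
  generator-coincidence pattern of the finitely many families is eventually constant as `t → 0⁺`
  (o-minimality: coincidence loci of semialgebraic families are semialgebraic in `t`), so the identity
  `S.gen t − S'.gen t = Σ sᵢ Mᵢ(t)` in the free abelian group on raw pairs specialises to an identity
  among the LIMIT symbols, in which each limit move instance is a relation by the per-move stubs, and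
  coinciding symbols have `L¹`-limits with a.e.-equal data, congruent by `SpAeCongruence` (item 3156,
  landed); hence `[ρ₀] − [ρ₀'] ∈ KZ.relations`.

Assembly `SpTameUniformClosure_of` = `stub_symbolBookkeeping` applied to the four per-move stubs
(kernel-checked; `sorry` only inside the five `stub_*`).

Disproof used: none relevant (no `Disproof.lean` / Negative lemma for 18036 or 3155; `ledger negatives`:
1 entry, KinematicPlaneConvex, unrelated). Dead lines avoided: the typed-arc collapse (arcs
`ℝ → KZ.IntegralRep n` are eventually constant) — raw families with real fibres are used throughout.

References: Kontsevich–Zagier 2001 §1.2 [KontsevichZagier2001]; van den Dries 1998 Ch. 6 (1.2), Ch. 9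
[Dries1998]; Lion–Rolin 1998 [LionRolin1998]; Comte–Lion–Rolin 2000 [ComteLionRolin2000];
Cluckers–Miller 2011 Thm 1.3 [CluckersMiller2011]; Bochnak–Coste–Roy 1998 §2.2 [BochnakCosteRoy1998].
-/

noncomputable section

open Set MeasureTheory Filter
open scoped Topology
open Literature.NumberTheory.Transcendental
open Literature.ModelTheory.ExponentialFields (IsSemialgebraic)
open Summit.KontsevichZagierPeriods.KontsevichZagierPeriods.Theses.StandardParts (SpTameUniformClosure)
open Summit.KontsevichZagierPeriods.KontsevichZagierPeriods.Theses.InequalityCost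
  (AddLimits TameCovLimit TameNLLimit TameLimitExists)

namespace Summit.KontsevichZagierPeriods.KontsevichZagierPeriods.Cruxes.SpTameUniformClosure.Birth

/-! ## Stubs of the line -/

/-- STUB `stub_addFamilyLimits` (M). **Tame closure for rule (1), both halves, over move-family
structures.** (a) If `M` is an `N`-tame family over `(0,1)` of domain-additivity instances
(`KZ.RawDomainAddFamilyOn`) whose whole / left / right families converge in `L¹` to `r`, `r₁`, `r₂`,
then `[r] − [r₁] − [r₂] ∈ KZ.relations`; (b) the same for integrand-additivity families
(`KZ.RawIntegrandAddFamilyOn`). Half (a) is implied verbatim by InequalityCost.AddLimits (item 8991, provable-now), see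
`domainAddFamilyLimits_of_addLimits`; half (b) likewise after cutting the total domain to the slab over `(0,1)`. [cite: KontsevichZagier2001, §1.2 rule (1)] [cite: BochnakCosteRoy1998, §2.2] -/
theorem stub_addFamilyLimits :
    (∀ (N n : ℕ) (M : KZ.RawDomainAddFamilyOn (Set.Ioo (0:ℝ) 1) n) (r r₁ r₂ : KZ.IntegralRep n),
      M.IsTame N → M.whole.HasL1Limit r → M.left.HasL1Limit r₁ → M.right.HasL1Limit r₂ →
      KZ.of r - KZ.of r₁ - KZ.of r₂ ∈ KZ.relations) ∧
    (∀ (N n : ℕ) (M : KZ.RawIntegrandAddFamilyOn (Set.Ioo (0:ℝ) 1) n) (r r₁ r₂ : KZ.IntegralRep n),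
      M.IsTame N → M.whole.HasL1Limit r → M.left.HasL1Limit r₁ → M.right.HasL1Limit r₂ →
      KZ.of r - KZ.of r₁ - KZ.of r₂ ∈ KZ.relations) := by
  sorry

/-- STUB `stub_covFamilyLimit` (L). **Tame closure for rule (2) over `KZ.RawCovFamilyOn`.** If `M` is an
`N`-tame family over `(0,1)` of change-of-variables instances whose source and target families converge
in `L¹` to `r₀`, `r₀'`, then `KZ.Equivalent r₀ r₀'`. The Jacobian is not bounded: degeneration of the
fibre maps `φ_t` as `t → 0⁺` is the content. Implied by InequalityCost.TameCovLimit (item 8987), see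
`covFamilyLimit_of_tameCovLimit`. [cite: KontsevichZagier2001, §1.2 rule (2)] [cite: Dries1998, Ch. 9]
[cite: ComteLionRolin2000, Thm 1] -/
theorem stub_covFamilyLimit :
    ∀ (N n : ℕ) (M : KZ.RawCovFamilyOn (Set.Ioo (0:ℝ) 1) n) (r₀ r₀' : KZ.IntegralRep n),
      M.IsTame N → M.source.HasL1Limit r₀ → M.target.HasL1Limit r₀' → KZ.Equivalent r₀ r₀' := by
  sorry

/-- STUB `stub_nlFamilyLimit` (L). **Tame closure for rule (3) over `KZ.RawNLFamilyOn`.** If `M` is an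
`N`-tame family over `(0,1)` of Newton–Leibniz instances whose band and base families converge in `L¹`
to `r₀` (dimension `n + 1`) and `r₀'` (dimension `n`), then `KZ.Equivalent r₀ r₀'`. Implied by
InequalityCost.TameNLLimit (item 8989), see `nlFamilyLimit_of_tameNLLimit`.
[cite: KontsevichZagier2001, §1.2 rule (3)] [cite: Dries1998, Ch. 9] [cite: LionRolin1998, Thm 1] -/
theorem stub_nlFamilyLimit :
    ∀ (N n : ℕ) (M : KZ.RawNLFamilyOn (Set.Ioo (0:ℝ) 1) n) (r₀ : KZ.IntegralRep (n + 1))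
      (r₀' : KZ.IntegralRep n),
      M.IsTame N → M.band.HasL1Limit r₀ → M.base.HasL1Limit r₀' → KZ.Equivalent r₀ r₀' := by
  sorry

/-- STUB `stub_tameFamilyLimitExists` (M). **Tame raw families have `L¹`-limits at `0⁺`**: pointwise
limits of `t ↦ 𝟙_{S_t}(x) G(x,t)` exist by o-minimal monotonicity, the limit data are `∅`-definable hence
`ℚ`-semialgebraic and bounded, and dominated convergence gives `L¹`-convergence. Implied by
InequalityCost.TameLimitExists (item 8992, provable-now), see `tameFamilyLimitExists_of_tameLimitExists`.
[cite: Dries1998, Ch. 6 (1.2)] [cite: LionRolin1998, Thm 1] -/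
theorem stub_tameFamilyLimitExists :
    ∀ (N n : ℕ) (S : KZ.RawFamily n), S.IsTame N → ∃ r₀ : KZ.IntegralRep n, S.HasL1Limit r₀ := by
  sorry

/-- STUB `stub_symbolBookkeeping` (L; the hardest new work of the line). **The per-move tame closure
lemmas and the existence of limits imply the crux.** Given an `N`-tame uniform chain
`S.gen t − S'.gen t = Σᵢ sᵢ • Mᵢ(t)` over `(0, δ)`: rescale to `(0, 1)` (`RawMoveFamilyOn.rescale δ`,
bound `⌈N/δ⌉`); give every raw family occurring in the `Mᵢ` its `L¹`-limit representation (fourth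
hypothesis); the coincidence pattern of the finitely many fibre generators is semialgebraic in `t`, hence
constant on some `(0, ε)` (o-minimality), so the free-abelian-group identity specialises to the limit
symbols — coinciding symbols having a.e.-equal limit data, congruent by `SpAeCongruence` (item 3156,
landed) — and every limit move instance is a relation by the first three hypotheses; therefore
`[ρ₀] − [ρ₀'] ∈ KZ.relations`. Why it might fail: symbols distinct for `t > 0` whose limits merge, and
empty/null limit fibres, must be shown harmless (null representations are relations,
`KZ.of_mem_relations_of_volume_eq_zero`). [cite: KontsevichZagier2001, §1.2] [cite: Dries1998, Ch. 9]
[cite: CluckersMiller2011, Thm 1.3] -/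
theorem stub_symbolBookkeeping :
    ((∀ (N n : ℕ) (M : KZ.RawDomainAddFamilyOn (Set.Ioo (0:ℝ) 1) n) (r r₁ r₂ : KZ.IntegralRep n),
        M.IsTame N → M.whole.HasL1Limit r → M.left.HasL1Limit r₁ → M.right.HasL1Limit r₂ →
        KZ.of r - KZ.of r₁ - KZ.of r₂ ∈ KZ.relations) ∧
      (∀ (N n : ℕ) (M : KZ.RawIntegrandAddFamilyOn (Set.Ioo (0:ℝ) 1) n) (r r₁ r₂ : KZ.IntegralRep n),
        M.IsTame N → M.whole.HasL1Limit r → M.left.HasL1Limit r₁ → M.right.HasL1Limit r₂ →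
        KZ.of r - KZ.of r₁ - KZ.of r₂ ∈ KZ.relations)) →
    (∀ (N n : ℕ) (M : KZ.RawCovFamilyOn (Set.Ioo (0:ℝ) 1) n) (r₀ r₀' : KZ.IntegralRep n),
      M.IsTame N → M.source.HasL1Limit r₀ → M.target.HasL1Limit r₀' → KZ.Equivalent r₀ r₀') →
    (∀ (N n : ℕ) (M : KZ.RawNLFamilyOn (Set.Ioo (0:ℝ) 1) n) (r₀ : KZ.IntegralRep (n + 1))
      (r₀' : KZ.IntegralRep n),
      M.IsTame N → M.band.HasL1Limit r₀ → M.base.HasL1Limit r₀' → KZ.Equivalent r₀ r₀') →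
    (∀ (N n : ℕ) (S : KZ.RawFamily n), S.IsTame N → ∃ r₀ : KZ.IntegralRep n, S.HasL1Limit r₀) →
    SpTameUniformClosure := by
  sorry

/-! ## The stubs are dominated by the InequalityCost items (fully proved) -/

/-- InequalityCost.AddLimits (item 8991), first half, implies the domain-additivity half of
`stub_addFamilyLimits`: the fields of `KZ.RawDomainAddFamilyOn` over `(0,1)` are the side conditions
of the item, and `IsTame` / `HasL1Limit` are its boundedness and limit clauses verbatim. (The
integrand-additivity half follows from the item's second half in the same way once the total domain is
cut down to the slab over `(0,1)`, where the fibrewise identity `G_t = G₁_t + G₂_t` becomes the total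
identity the item asks; that Boolean cut is left to the prover of the stub.)
[cite: KontsevichZagier2001, §1.2 rule (1)] -/
theorem domainAddFamilyLimits_of_addLimits (h : AddLimits) :
    ∀ (N n : ℕ) (M : KZ.RawDomainAddFamilyOn (Set.Ioo (0:ℝ) 1) n) (r r₁ r₂ : KZ.IntegralRep n),
      M.IsTame N → M.whole.HasL1Limit r → M.left.HasL1Limit r₁ → M.right.HasL1Limit r₂ →
      KZ.of r - KZ.of r₁ - KZ.of r₂ ∈ KZ.relations := by
  intro N n M r r₁ r₂ hT hl hl₁ hl₂
  obtain ⟨-, hW, hL, hR⟩ := hT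
  refine h.1 N M.whole.total M.left.total M.right.total M.whole.integrand M.left.integrand
    M.right.integrand r r₁ r₂ M.whole.isSemialgebraic_total M.left.isSemialgebraic_total
    M.right.isSemialgebraic_total M.whole.isSemialgebraicFunOn_integrand
    M.left.isSemialgebraicFunOn_integrand M.right.isSemialgebraicFunOn_integrand ?_
    (fun z hz => (hW z hz).2) (fun z hz => (hL z hz).2) (fun z hz => (hR z hz).2) ?_ hl hl₁ hl₂
  · intro z hz i
    rcases hz with (hz | hz) | hz
    · exact (hW z hz).1 i
    · exact (hL z hz).1 i
    · exact (hR z hz).1 i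
  · intro t ht
    exact ⟨M.fibre_eq t ht, M.volume_inter t ht, fun x hx => M.eqOn_left t ht hx,
      fun x hx => M.eqOn_right t ht hx⟩

/-- InequalityCost.TameCovLimit (item 8987) implies `stub_covFamilyLimit` (unpack the structure).
[cite: KontsevichZagier2001, §1.2 rule (2)] -/
theorem covFamilyLimit_of_tameCovLimit (h : TameCovLimit) :
    ∀ (N n : ℕ) (M : KZ.RawCovFamilyOn (Set.Ioo (0:ℝ) 1) n) (r₀ r₀' : KZ.IntegralRep n),
      M.IsTame N → M.source.HasL1Limit r₀ → M.target.HasL1Limit r₀' → KZ.Equivalent r₀ r₀' := by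
  intro N n M r₀ r₀' hT hl hl'
  obtain ⟨-, hS, hS'⟩ := hT
  exact h N M.source.total M.target.total M.source.integrand M.target.integrand M.map r₀ r₀'
    M.source.isSemialgebraic_total M.source.isSemialgebraicFunOn_integrand
    M.target.isSemialgebraic_total M.target.isSemialgebraicFunOn_integrand M.isSemialgebraicMapOn_map
    hS hS' (fun t ht => ⟨M.injOn t ht, M.image_eq t ht, fun x hx => M.hasFDerivWithinAt t ht x hx⟩) hl hl'

/-- InequalityCost.TameNLLimit (item 8989) implies `stub_nlFamilyLimit` (unpack the structure).
[cite: KontsevichZagier2001, §1.2 rule (3)] -/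
theorem nlFamilyLimit_of_tameNLLimit (h : TameNLLimit) :
    ∀ (N n : ℕ) (M : KZ.RawNLFamilyOn (Set.Ioo (0:ℝ) 1) n) (r₀ : KZ.IntegralRep (n + 1))
      (r₀' : KZ.IntegralRep n),
      M.IsTame N → M.band.HasL1Limit r₀ → M.base.HasL1Limit r₀' → KZ.Equivalent r₀ r₀' := by
  intro N n M r₀ r₀' hT hl hl'
  obtain ⟨-, hB, hF, hT'⟩ := hT
  exact h N M.band.total M.base.total M.band.integrand M.prim M.base.integrand M.lower M.upper r₀ r₀'
    M.band.isSemialgebraic_total M.base.isSemialgebraic_total M.band.isSemialgebraicFunOn_integrand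
    M.isSemialgebraicFunOn_prim M.base.isSemialgebraicFunOn_integrand M.isSemialgebraicFunOn_lower
    M.isSemialgebraicFunOn_upper (fun z hz => ⟨(hB z hz).1, (hB z hz).2, hF z hz⟩) hT'
    (fun t ht => ⟨M.lower_le_upper t ht, M.fibre_band t ht, M.continuousOn t ht, M.hasDerivAt t ht,
      M.base_eq t ht⟩) hl hl'

/-- InequalityCost.TameLimitExists (item 8992) implies `stub_tameFamilyLimitExists`.
[cite: Dries1998, Ch. 6 (1.2)] -/
theorem tameFamilyLimitExists_of_tameLimitExists (h : TameLimitExists) :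
    ∀ (N n : ℕ) (S : KZ.RawFamily n), S.IsTame N → ∃ r₀ : KZ.IntegralRep n, S.HasL1Limit r₀ :=
  fun N _ S hT => h N S.total S.integrand S.isSemialgebraic_total S.isSemialgebraicFunOn_integrand hT

/-! ## Assembly (kernel-checked; `sorry` only through the five declared stubs): concludes the crux BY NAME -/

/-- **ASSEMBLY `SpTameUniformClosure_of`.** The per-move tame closure stubs, the existence of limits and
the bookkeeping stub give the crux `StandardParts.SpTameUniformClosure` by name.
[cite: KontsevichZagier2001, §1.2] -/
theorem SpTameUniformClosure_of : SpTameUniformClosure :=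
  stub_symbolBookkeeping stub_addFamilyLimits stub_covFamilyLimit stub_nlFamilyLimit
    stub_tameFamilyLimitExists

end Summit.KontsevichZagierPeriods.KontsevichZagierPeriods.Cruxes.SpTameUniformClosure.Birth
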